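import Summits.QuantumFields.BalabanUV.T4Continuum.Support.ShellMeasureAverageReal

/-!
# `T4Continuum.ShellMeasureAverageHStructure` — (LR)_j ∕ W-d: p. 267's OPERATOR `h` OF THE PRINTED BLOCK AVERAGE IS
# ⋆-EQUIVARIANT (REAL) over a unitary background — the `hhop` hypothesis of `ShellMeasureLinearizedFromQ` for
# `B12AverageCorridor267.hGen`, from row S47's ⋆-equivariance of the average read along the corridor curves
(cell `pub-balaban`, sub-cell `t4`, spine estimate NE7c (node U5b); NE7c ROUND-2 crew `t4-ne7c-formalise-*`, seat
`b2b-balaban-t4-ne7c-formalise-leaf-05` gen 6; own-initiative leaf on WALL §3 W-d (its analytic half, owner cut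
gen 28, rows S46–S49), journal OFFER «THE `hop`-SIDE OF S46 FOR p. 267's `h`» l.13068, file 2 of 2 = item (b)
(item (a), the COMPLEX-linearity of `hGen` and its packaging `𝔸 →L[ℂ] 𝔸`, is row S48's — leaf-03-g3 «MINE» l.13093,
ACK l.13305 — and is NOT here); imports leaf-09-g8's S47 `ShellMeasureAverageReal` (p218692; hence
`Literature.…B12AverageCorridor267`, `B12HOperatorNeumann267`, `B12HOperator267`) ONLY, all BY NAME; [folklore]
linear algebra + one-variable calculus + C⋆-bookkeeping; page numbers LOCATE displayed shapes; 0 `def`,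
0 `def … : Prop`, 0 sorry, 0 citations)

HONEST FRAMING.  Finite four-torus programme, rung (B)+1 only — NOT infinite volume, NOT a mass gap, NOT the Clay
problem, NOT summit progress; (B), `BetaPertHyp`, (B^μ) not consumed.  NE7c (`T4IndicatorShell.ShellWeightBound`) is
NOT PRINTED and NOT PROVED; «NE7c ⇐ the named binders».  Nothing of [Balaban 1983–89] is asserted beyond what
`B12AverageCorridor267` transcribes ((2.4) ∕ [Balaban1985Averaging] (15) as the typed `Qtilde`, p. 267's `h` as the
kernel object `hGen` — «the operator h satisfies the identity LQ̃h = I … h(c) is a linear operator on the Lie algebra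
𝐠, equal to an inverse of a coefficient at the variable B′(b₀(c)) in (Q̃B′)(c)», [Balaban1987RG1] p. 267).  That
module builds `hGen c : 𝔸 →L[ℝ] 𝔸` by a Neumann series in the REAL framework of `B12HOperatorNeumann267` and records
NO reality statement («any use of 𝐠 ⊂ 𝔸 (reality, tracelessness) — none is needed»).  Row S46
(`ShellMeasureLinearizedFromQ.realForm_chartData_of_Q`) consumes the right inverse `hop` with, among others,
`hhop : hop (κ_𝒳 X) = κ_𝒴 (hop X)` — print's «𝐠-valued»: REAL fields go to REAL fields —; THIS file proves it
fibrewise for `hop := hOp b₀ hGen`, `κ := star` componentwise (S47's conjugation).  NO estimate of Bałaban's is proved;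
NOTHING in the countdown moves; NE7c NOT PROVED; spine PROVED 0/9.  HONEST DEPENDENCY (cell): continuum YM on T⁴ ⇐
BetaPertH ∧ nine spine estimates (0/9 proved); BetaPertH ⇐ (D1) ∧ (D4) ∧ CAP+tail; G-an2-4 gates asym, D1 and NE2/3/4.

WHAT IS PROVED (hypotheses of `B12AverageCorridor267.h_paragraph_p267_genuine` throughout: `𝒯` block-local and
axis-straight, `‖W_x(V) − 1‖ ≤ ε ≤ 1∕8` on the off-axis block loops, `‖V b‖, ‖(V b)⁻¹‖ ≤ 1`, `(Lᵈ∕L)·24ε < 1`):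
* §1 `h(c)` IS THE TWO-SIDED INVERSE of the corridor coefficient read as the CLM `bcoefL L 𝒯 V c` of
  `B12AverageCorridor267` §6 (`K(c) − S(c) = bcoefL(c)` pointwise: `KMain_apply`, `coefL_apply_eq_coef`, `Scorr_apply`;
  `perturb_perturbInv` ∕ `perturbInv_perturb` BY NAME): `bcoefL_hGen`, `hGen_bcoefL`.
* §2 REALITY FROM A DISPLAYED IDENTITY (any `[StarRing 𝔸] [StarModule ℂ 𝔸] [ContinuousStar 𝔸]`): from
  `hstar : ∀ X, ∀ᶠ t : ℝ in 𝓝 0, star (Q̃_V(t•δ_{b₀(c)}X)(c)) = Q̃_V(t•δ_{b₀(c)}(X⋆))(c)` the corridor coefficient is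
  ⋆-equivariant — **`bcoefVal_star`** (the complex `HasDerivAt` along the corridor direction
  `hasDerivAt_Qtilde_single` BY NAME, restricted to the real line, `star` the real CLM `starL' ℝ`, uniqueness of the
  derivative under eventual equality), `LQ_single_star` — hence **`hGen_star : h(c)(X⋆) = (h(c) X)⋆`** and, for
  coarse fields, `hOp_hGen_star : hOp b₀ h (B⋆) = (hOp b₀ h B)⋆`.
* §3 **`hstar` DISCHARGED** (`[CStarRing 𝔸]`, e.g. `M_N(ℂ)`; `V b` UNITARY; `𝒯` θ-equivariant for
  `ShellMeasureAverageReal.theta`, `θ u = (u⋆)⁻¹`): row S47's `ShellMeasureAverageReal.star_Qtilde` holds ALONG THE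
  CORRIDOR CURVE for small real `t` (`eventually_star_Qtilde_single`) because its three `mlog`-regime hypotheses hold
  eventually — the off-axis loops of `V′_sV` are `W_x(V)·e^{−s·iX̃}` (`loopW_pert_single_of_mem_offAxis`), continuous
  in `s`, the axis loops are `1` (`loopW_axisSite`), and the quotient `M_c(V′_sV)M_c(V)⁻¹ = e^{E(s)}e^{s·iX̃}e^{−Y} → 1`
  (`curve_eq`, `hasDerivAt_Eexp` BY NAME); hence **`hGen_star_unitary`**, **`hOp_hGen_star_unitary`** — S46's `hhop`
  for the printed average's `h` with NO `hstar` binder, from LOCATED hypotheses only (unitarity, small loops, budget).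
* §4 **`hGen_star_gammaT_unitary`**: the same for [B7] (15) VERBATIM (`𝒯 = gammaT`; `isBlockLocal_gammaT`,
  `isAxisStraightFamily_gammaT`, `theta_gammaT` BY NAME).
NON-VACUITY: `h_paragraph_p267_genuine`'s hypotheses are inhabited by `B12AverageCorridor267.flat_hypotheses`
(`V ≡ 1` — unitary —, `ε = 0`), which also inhabits §3–§4's.
WHICH END ∕ BINDER: the clause `hhop` of S46 `realForm_chartData_of_Q` ∕ S40 `realForm_chartData_fixed` ∕ S36
`realForm_chartData` (and `B12JacobianReal267`'s `hhop`) for the printed average's `h`, fibrewise; `hHop` is (iii) of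
`h_paragraph_p267_genuine` BY NAME; complex linearity + «LQ̃h = I» for the Fréchet derivative are row S48
(`ShellMeasureAverageDerivative`); the finite-region packaging is leaf-07-g4's `ShellMeasureAverageRegion` (offer
l.13209); the splitting `Ψ`∕`hΨ` is file 1 `ShellMeasureLinearizedKernelSplit` (p218988).  Mints nothing (trigger c2).
NOTHING in the countdown moves.
-/

noncomputable section

open Filter Topology NormedSpace

namespace Summit.QuantumFields.BalabanUV.T4Continuum.ShellMeasureAverageHStructure

open Literature.MathematicalPhysics.QuantumFieldTheory.Balaban1983to89
open Literature.MathematicalPhysics.QuantumLattice (ZdEdge)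
open B13CorridorSeparation (b0Z b0Z_injective)
open B13PkLocalTerms (hOp hOp_apply_b₀ hOp_eq_zero_off_range)
open B12HOperator267 (bcoef gammaT)
open B12HOperatorNeumann267 (perturb_perturbInv perturbInv_perturb KMain KMain_apply)
open Literature.MathematicalPhysics.QuantumLattice (blockSites)
open B7Eq78Linearization (conjR)
open B12HOperator267 (axisSite gcorner)
open B12AverageCorridor267 (IsBlockLocal IsAxisStraightFamily offAxis axisSites loopW loopW_axisSite avgM pert pert_zero
  expU Qtilde LQ bcoefVal bcoefL bcoefL_apply bcoef_LQ coefL_apply_eq_coef Scorr Scorr_apply axisStraight_conj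
  norm_Rconj_le norm_Rconj_inv_le relPert_lt_one hGen hasDerivAt_Qtilde_single loopW_pert_single_of_mem_offAxis
  val_conj_expU_inv Eexp Yexp Eexp_zero hasDerivAt_Eexp curve_eq isBlockLocal_gammaT isAxisStraightFamily_gammaT)
open ShellMeasureAverageReal (theta star_Qtilde theta_gammaT)

variable {d : ℕ} {𝔸 : Type*} [NormedRing 𝔸] [NormedAlgebra ℂ 𝔸] [NormOneClass 𝔸] [CompleteSpace 𝔸]
  {L : ℕ} {𝒯 : (ZdEdge d → 𝔸ˣ) → (Fin d → ℤ) → 𝔸ˣ}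

/-! ## §1 `h(c)` is the two-sided inverse of the complex-linear corridor coefficient `bcoefL(c)` -/

section Inverse

variable (hL : 0 < L) (h𝒯 : IsBlockLocal L 𝒯) (h𝒯' : IsAxisStraightFamily L 𝒯) (V : ZdEdge d → 𝔸ˣ) {ε : ℝ}
  (hε0 : 0 ≤ ε) (hε : ε ≤ 1 / 8) (hW : ∀ c, ∀ x ∈ offAxis L c, ‖((loopW L 𝒯 V c x : 𝔸ˣ) : 𝔸) - 1‖ ≤ ε)
  (hV : ∀ b, ‖((V b : 𝔸ˣ) : 𝔸)‖ ≤ 1) (hV' : ∀ b, ‖(((V b)⁻¹ : 𝔸ˣ) : 𝔸)‖ ≤ 1)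
  (hbud : (L : ℝ) ^ d / L * (24 * ε) < 1)

include h𝒯' in
/-- **`K(c) − S(c) = bcoefL(c)`**: the perturbed main term that `hGen` inverts IS (pointwise) the complex-linear
corridor coefficient `bcoefL` of `B12AverageCorridor267` §6 (`KMain = coef = coefL` under axis straightness,
`S(c) = coefL − bcoefL`). [folklore] -/
theorem KMain_sub_Scorr_apply (c : ZdEdge d) (X : 𝔸) :
    ((KMain (axisStraight_conj h𝒯' V) hL (norm_Rconj_le hV) (norm_Rconj_inv_le hV') c : 𝔸 →L[ℝ] 𝔸)
        - Scorr L 𝒯 V c) X = bcoefL L 𝒯 V c X := by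
  rw [sub_apply, ContinuousLinearEquiv.coe_coe, KMain_apply, Scorr_apply, coefL_apply_eq_coef h𝒯' V c X,
    sub_sub_cancel]

/-- **`bcoefL(c) (h(c) X) = X`** — «LQ̃h = I» at the level of the fibre map, for the CLOSED-FORM coefficient
(`B12HOperatorNeumann267.perturb_perturbInv` BY NAME). [folklore] -/
theorem bcoefL_hGen (c : ZdEdge d) (X : 𝔸) :
    bcoefL L 𝒯 V c (hGen hL h𝒯' V hε0 hε hW hV hV' hbud c X) = X := by
  rw [← KMain_sub_Scorr_apply hL h𝒯' V hV hV' c]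
  exact perturb_perturbInv _ _ (relPert_lt_one hL h𝒯' V hε0 hε hW hV hV' hbud c) X

/-- **`h(c) (bcoefL(c) X) = X`** — `h(c)` is also a LEFT inverse (`perturbInv_perturb` BY NAME): the fibre map is the
two-sided inverse of the complex-linear bijection `bcoefL(c)`. [folklore] -/
theorem hGen_bcoefL (c : ZdEdge d) (X : 𝔸) :
    hGen hL h𝒯' V hε0 hε hW hV hV' hbud c (bcoefL L 𝒯 V c X) = X := by
  have h := perturbInv_perturb (KMain (axisStraight_conj h𝒯' V) hL (norm_Rconj_le hV) (norm_Rconj_inv_le hV') c)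
    (Scorr L 𝒯 V c) (relPert_lt_one hL h𝒯' V hε0 hε hW hV hV' hbud c) X
  rwa [KMain_sub_Scorr_apply hL h𝒯' V hV hV' c] at h

end Inverse

/-! ## §2 Reality: `h(c)` commutes with `star` when the average is ⋆-equivariant along the corridor curve -/

section Star

variable [StarRing 𝔸] [StarModule ℂ 𝔸] [ContinuousStar 𝔸]

omit [NormOneClass 𝔸] [CompleteSpace 𝔸] [StarRing 𝔸] [StarModule ℂ 𝔸] [ContinuousStar 𝔸] in
/-- restriction of a complex curve to the real line keeps the derivative: `HasDerivAt f f′ (t : ℂ)` ⟹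
`HasDerivAt (fun t : ℝ => f t) f′ t` (the `𝔸`-valued form of Mathlib's `HasDerivAt.comp_ofReal`). [folklore] -/
theorem hasDerivAt_comp_ofReal {f : ℂ → 𝔸} {f' : 𝔸} {t : ℝ} (hf : HasDerivAt f f' (t : ℂ)) :
    HasDerivAt (fun s : ℝ => f (s : ℂ)) f' t := by
  have h := (hf.hasFDerivAt.restrictScalars ℝ).comp_hasDerivAt t Complex.ofRealCLM.hasDerivAt
  refine h.congr_deriv ?_
  simp only [ContinuousLinearMap.coe_restrictScalars', Complex.ofRealCLM_apply, Complex.ofReal_one,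
    ContinuousLinearMap.toSpanSingleton_apply, one_smul]

/-- **⋆-EQUIVARIANCE OF THE CORRIDOR COEFFICIENT.**  If, for small real `t`, the average is ⋆-equivariant along the
corridor curve at `c` (row S47's identity read on the curve; DISPLAYED here, DISCHARGED in §3), then
`bcoef(c)(star X) = star (bcoef(c) X)`: both sides are derivatives at `t = 0` of real curves that agree near `0`
(`hasDerivAt_Qtilde_single` BY NAME; small field `‖W_x(V) − 1‖ < 1` off-axis). [folklore] -/
theorem bcoefVal_star (hL : 0 < L) (h𝒯 : IsBlockLocal L 𝒯) (h𝒯' : IsAxisStraightFamily L 𝒯)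
    (V : ZdEdge d → 𝔸ˣ) (c : ZdEdge d) (X : 𝔸)
    (hW : ∀ x ∈ offAxis L c, ‖((loopW L 𝒯 V c x : 𝔸ˣ) : 𝔸) - 1‖ < 1)
    (hstar : ∀ᶠ t : ℝ in 𝓝 0, star (Qtilde L 𝒯 V ((t : ℂ) • Pi.single (b0Z L c) X) c)
      = Qtilde L 𝒯 V ((t : ℂ) • Pi.single (b0Z L c) (star X)) c) :
    bcoefVal L 𝒯 V c (star X) = star (bcoefVal L 𝒯 V c X) := by
  have h0 : HasDerivAt (fun t : ℝ => Qtilde L 𝒯 V ((t : ℂ) • Pi.single (b0Z L c) X) c)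
      (bcoefVal L 𝒯 V c X) 0 :=
    hasDerivAt_comp_ofReal (t := 0)
      (by simpa only [Complex.ofReal_zero] using hasDerivAt_Qtilde_single hL h𝒯 h𝒯' V c X hW)
  -- `star` is the REAL continuous linear map `starL' ℝ` (the tree's `QuantumLattice.hasDerivAt_star_comp` is the
  -- finite-dimensional case; here only `ContinuousStar` is available, so the two lines are inlined)
  have hf : HasDerivAt (fun t : ℝ => star (Qtilde L 𝒯 V ((t : ℂ) • Pi.single (b0Z L c) X) c))
      (star (bcoefVal L 𝒯 V c X)) 0 := by
    have h := ((starL' ℝ : 𝔸 ≃L[ℝ] 𝔸) : 𝔸 →L[ℝ] 𝔸).hasFDerivAt.comp_hasDerivAt (0 : ℝ) h0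
    simpa only [Function.comp_def, ContinuousLinearEquiv.coe_coe, starL'_apply] using h
  have hg : HasDerivAt (fun t : ℝ => Qtilde L 𝒯 V ((t : ℂ) • Pi.single (b0Z L c) (star X)) c)
      (bcoefVal L 𝒯 V c (star X)) 0 :=
    hasDerivAt_comp_ofReal (t := 0)
      (by simpa only [Complex.ofReal_zero] using hasDerivAt_Qtilde_single hL h𝒯 h𝒯' V c (star X) hW)
  exact (hg.congr_of_eventuallyEq hstar).unique hf

/-- the same for the genuine linearization: `LQ̃_V(δ_{b₀(c)}(star X))(c) = star (LQ̃_V(δ_{b₀(c)}X)(c))`. [folklore] -/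
theorem LQ_single_star (hL : 0 < L) (h𝒯 : IsBlockLocal L 𝒯) (h𝒯' : IsAxisStraightFamily L 𝒯)
    (V : ZdEdge d → 𝔸ˣ) (c : ZdEdge d) (X : 𝔸)
    (hW : ∀ x ∈ offAxis L c, ‖((loopW L 𝒯 V c x : 𝔸ˣ) : 𝔸) - 1‖ < 1)
    (hstar : ∀ᶠ t : ℝ in 𝓝 0, star (Qtilde L 𝒯 V ((t : ℂ) • Pi.single (b0Z L c) X) c)
      = Qtilde L 𝒯 V ((t : ℂ) • Pi.single (b0Z L c) (star X)) c) :
    LQ L 𝒯 V (Pi.single (b0Z L c) (star X)) c = star (LQ L 𝒯 V (Pi.single (b0Z L c) X) c) :=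
  (bcoef_LQ hL h𝒯 h𝒯' V c (star X) hW).trans
    ((bcoefVal_star hL h𝒯 h𝒯' V c X hW hstar).trans (congrArg star (bcoef_LQ hL h𝒯 h𝒯' V c X hW).symm))

variable (hL : 0 < L) (h𝒯 : IsBlockLocal L 𝒯) (h𝒯' : IsAxisStraightFamily L 𝒯) (V : ZdEdge d → 𝔸ˣ) {ε : ℝ}
  (hε0 : 0 ≤ ε) (hε : ε ≤ 1 / 8) (hW : ∀ c, ∀ x ∈ offAxis L c, ‖((loopW L 𝒯 V c x : 𝔸ˣ) : 𝔸) - 1‖ ≤ ε)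
  (hV : ∀ b, ‖((V b : 𝔸ˣ) : 𝔸)‖ ≤ 1) (hV' : ∀ b, ‖(((V b)⁻¹ : 𝔸ˣ) : 𝔸)‖ ≤ 1)
  (hbud : (L : ℝ) ^ d / L * (24 * ε) < 1)

include h𝒯 in
/-- **`h(c)` IS ⋆-EQUIVARIANT**: under ⋆-equivariance of the average along the corridor curve at `c` (for every
direction `X`), `h(c)(star X) = star (h(c) X)` — the two-sided inverse of a ⋆-equivariant bijection.  This is S46's
`hhop : hop (κ_𝒳 X) = κ_𝒴 (hop X)` for `κ := star` componentwise, per fibre. [folklore] -/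
theorem hGen_star (c : ZdEdge d)
    (hstar : ∀ X : 𝔸, ∀ᶠ t : ℝ in 𝓝 0, star (Qtilde L 𝒯 V ((t : ℂ) • Pi.single (b0Z L c) X) c)
      = Qtilde L 𝒯 V ((t : ℂ) • Pi.single (b0Z L c) (star X)) c) (X : 𝔸) :
    hGen hL h𝒯' V hε0 hε hW hV hV' hbud c (star X) = star (hGen hL h𝒯' V hε0 hε hW hV hV' hbud c X) := by
  set Y := hGen hL h𝒯' V hε0 hε hW hV hV' hbud c X with hY
  have hWc : ∀ x ∈ offAxis L c, ‖((loopW L 𝒯 V c x : 𝔸ˣ) : 𝔸) - 1‖ < 1 :=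
    fun x hx => (hW c x hx).trans_lt (by linarith)
  have h1 : bcoefL L 𝒯 V c Y = X := bcoefL_hGen hL h𝒯' V hε0 hε hW hV hV' hbud c X
  have h2 : bcoefL L 𝒯 V c (star Y) = star X := by
    rw [bcoefL_apply, bcoefVal_star hL h𝒯 h𝒯' V c Y hWc (hstar Y), ← bcoefL_apply, h1]
  rw [← h2, hGen_bcoefL hL h𝒯' V hε0 hε hW hV hV' hbud c]

include h𝒯 in
/-- **THE FIELD OPERATOR IS ⋆-EQUIVARIANT**: `hOp b₀ h (star B) = star (hOp b₀ h B)` for coarse fields `B` (`star`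
componentwise), under ⋆-equivariance of the average along every corridor curve — S46's `hhop` for the printed
average's `h`, modulo row S47. [folklore] -/
theorem hOp_hGen_star
    (hstar : ∀ c, ∀ X : 𝔸, ∀ᶠ t : ℝ in 𝓝 0, star (Qtilde L 𝒯 V ((t : ℂ) • Pi.single (b0Z L c) X) c)
      = Qtilde L 𝒯 V ((t : ℂ) • Pi.single (b0Z L c) (star X)) c) (B : ZdEdge d → 𝔸) :
    hOp (b0Z L) (fun c X => hGen hL h𝒯' V hε0 hε hW hV hV' hbud c X) (star B)
      = star (hOp (b0Z L) (fun c X => hGen hL h𝒯' V hε0 hε hW hV hV' hbud c X) B) := by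
  funext b
  by_cases hb : ∃ c, b0Z L c = b
  · obtain ⟨c, rfl⟩ := hb
    rw [Pi.star_apply, hOp_apply_b₀ (b0Z_injective hL), hOp_apply_b₀ (b0Z_injective hL), Pi.star_apply,
      hGen_star hL h𝒯 h𝒯' V hε0 hε hW hV hV' hbud c (hstar c)]
  · rw [Pi.star_apply, hOp_eq_zero_off_range _ _ hb, hOp_eq_zero_off_range _ _ hb, star_zero]

end Star

/-! ## §3 Discharging `hstar` over a UNITARY background in a C⋆-algebra: row S47 read along the corridor curve -/

section Unitary

variable [StarRing 𝔸] [CStarRing 𝔸] [StarModule ℂ 𝔸]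

omit [NormOneClass 𝔸] [StarRing 𝔸] [CStarRing 𝔸] [StarModule ℂ 𝔸] in
/-- the OFF-AXIS block loops along the corridor curve are `W_x(V)·e^{−s·iX̃}` (`loopW_pert_single_of_mem_offAxis`,
`val_conj_expU_inv` BY NAME), hence CONTINUOUS in `s`. [folklore] -/
theorem continuous_loopW_pert_single (hL : 0 < L) (h𝒯 : IsBlockLocal L 𝒯) (V : ZdEdge d → 𝔸ˣ) (c : ZdEdge d)
    (X : 𝔸) {x : Fin d → ℤ} (hx : x ∈ offAxis L c) :
    Continuous fun s : ℂ => ((loopW L 𝒯 (pert (s • Pi.single (b0Z L c) X) V) c x : 𝔸ˣ) : 𝔸) := by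
  letI : NormedAlgebra ℚ 𝔸 := NormedAlgebra.restrictScalars ℚ ℂ 𝔸
  have h : (fun s : ℂ => ((loopW L 𝒯 (pert (s • Pi.single (b0Z L c) X) V) c x : 𝔸ˣ) : 𝔸))
      = fun s => ((loopW L 𝒯 V c x : 𝔸ˣ) : 𝔸) * exp (s • (-(Complex.I • conjR (gcorner L V c) X))) := by
    funext s
    rw [loopW_pert_single_of_mem_offAxis hL h𝒯 V c X s hx, Units.val_mul, val_conj_expU_inv]
  rw [h]
  exact continuous_const.mul (exp_continuous.comp (continuous_id.smul continuous_const))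

omit [NormedAlgebra ℂ 𝔸] [NormOneClass 𝔸] [CompleteSpace 𝔸] [StarRing 𝔸] [CStarRing 𝔸] [StarModule ℂ 𝔸] in
/-- a bound on the OFF-AXIS loops is a bound on ALL block loops once it holds for the trivial loop `1` — a block site
off `offAxis` is an axis site, whose loop is `1` for every configuration (`loopW_axisSite`). [folklore] -/
theorem loops_blockSites_of_offAxis (h𝒯' : IsAxisStraightFamily L 𝒯) (U : ZdEdge d → 𝔸ˣ) (c : ZdEdge d)
    {r : ℝ} (hr : 0 ≤ r) (hW : ∀ x ∈ offAxis L c, ‖((loopW L 𝒯 U c x : 𝔸ˣ) : 𝔸) - 1‖ ≤ r) :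
    ∀ x ∈ blockSites L c.1, ‖((loopW L 𝒯 U c x : 𝔸ˣ) : 𝔸) - 1‖ ≤ r := by
  intro x hx
  by_cases hxo : x ∈ offAxis L c
  · exact hW x hxo
  · have hxa : x ∈ axisSites L c := by
      by_contra h
      exact hxo (Finset.mem_filter.2 ⟨hx, h⟩)
    obtain ⟨l, hl, rfl⟩ := Finset.mem_image.1 hxa
    rw [loopW_axisSite h𝒯' U c (Finset.mem_range.1 hl), Units.val_one, sub_self, norm_zero]
    exact hr

omit [NormOneClass 𝔸] [StarRing 𝔸] [CStarRing 𝔸] [StarModule ℂ 𝔸] in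
/-- **EVENTUALLY IN THE `mlog` REGIME (loops)**: if the off-axis loops of `V` satisfy `‖W_x(V) − 1‖ < 1∕3`, then for
`s` near `0` ALL block loops of `V′_sV`, `V′_s = exp(is·δ_{b₀(c)}X)`, satisfy `‖· − 1‖ ≤ 1∕3` (continuity in `s`;
axis loops are `1`). [folklore] -/
theorem eventually_loops_mlogRegime (hL : 0 < L) (h𝒯 : IsBlockLocal L 𝒯) (h𝒯' : IsAxisStraightFamily L 𝒯)
    (V : ZdEdge d → 𝔸ˣ) (c : ZdEdge d) (X : 𝔸)
    (hW : ∀ x ∈ offAxis L c, ‖((loopW L 𝒯 V c x : 𝔸ˣ) : 𝔸) - 1‖ < 1 / 3) :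
    ∀ᶠ s : ℂ in 𝓝 0, ∀ x ∈ blockSites L c.1,
      ‖((loopW L 𝒯 (pert (s • Pi.single (b0Z L c) X) V) c x : 𝔸ˣ) : 𝔸) - 1‖ ≤ 1 / 3 := by
  have hoff : ∀ᶠ s : ℂ in 𝓝 0, ∀ x ∈ offAxis L c,
      ‖((loopW L 𝒯 (pert (s • Pi.single (b0Z L c) X) V) c x : 𝔸ˣ) : 𝔸) - 1‖ ≤ 1 / 3 := by
    rw [Filter.eventually_all_finset]
    intro x hxo
    have hcont : Continuous fun s : ℂ =>
        ‖((loopW L 𝒯 (pert (s • Pi.single (b0Z L c) X) V) c x : 𝔸ˣ) : 𝔸) - 1‖ :=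
      ((continuous_loopW_pert_single hL h𝒯 V c X hxo).sub continuous_const).norm
    have hc : Tendsto (fun s : ℂ => ‖((loopW L 𝒯 (pert (s • Pi.single (b0Z L c) X) V) c x : 𝔸ˣ) : 𝔸) - 1‖)
        (𝓝 0) (𝓝 ‖((loopW L 𝒯 V c x : 𝔸ˣ) : 𝔸) - 1‖) :=
      hcont.tendsto' 0 _ (by rw [zero_smul, pert_zero])
    exact (hc.eventually_lt_const (hW x hxo)).mono fun s hs => hs.le
  exact hoff.mono fun s hs => loops_blockSites_of_offAxis h𝒯' _ c (by norm_num) hs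

omit [NormOneClass 𝔸] [StarRing 𝔸] [CStarRing 𝔸] [StarModule ℂ 𝔸] in
/-- **THE QUOTIENT `Z(s) = M_c(V′_sV)M_c(V)⁻¹` TENDS TO `1`** along the corridor curve (`curve_eq` BY NAME:
`Z(s) = e^{E(s)}e^{s·iX̃}e^{−Y}`, `E` differentiable at `0` by `hasDerivAt_Eexp`, `E(0) = Y`). [folklore] -/
theorem tendsto_quot_pert_single (hL : 0 < L) (h𝒯 : IsBlockLocal L 𝒯) (h𝒯' : IsAxisStraightFamily L 𝒯)
    (V : ZdEdge d → 𝔸ˣ) (c : ZdEdge d) (X : 𝔸)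
    (hW : ∀ x ∈ offAxis L c, ‖((loopW L 𝒯 V c x : 𝔸ˣ) : 𝔸) - 1‖ < 1) :
    Tendsto (fun s : ℂ => ((avgM L 𝒯 (pert (s • Pi.single (b0Z L c) X) V) c * (avgM L 𝒯 V c)⁻¹ : 𝔸ˣ) : 𝔸))
      (𝓝 0) (𝓝 1) := by
  letI : NormedAlgebra ℚ 𝔸 := NormedAlgebra.restrictScalars ℚ ℂ 𝔸
  have hcurve : (fun s : ℂ => ((avgM L 𝒯 (pert (s • Pi.single (b0Z L c) X) V) c * (avgM L 𝒯 V c)⁻¹ : 𝔸ˣ) : 𝔸))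
      = fun s => exp (Eexp L 𝒯 V c X s) * exp (s • (Complex.I • conjR (gcorner L V c) X)) * exp (-Yexp L 𝒯 V c) :=
    funext fun s => curve_eq hL h𝒯 h𝒯' V c X s
  rw [hcurve]
  have hE : Tendsto (Eexp L 𝒯 V c X) (𝓝 0) (𝓝 (Yexp L 𝒯 V c)) := by
    have h := (hasDerivAt_Eexp V c X hW).continuousAt.tendsto
    rwa [Eexp_zero] at h
  have h1 : Tendsto (fun s => exp (Eexp L 𝒯 V c X s)) (𝓝 0) (𝓝 (exp (Yexp L 𝒯 V c))) :=
    (exp_continuous.tendsto _).comp hE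
  have h2c : Continuous fun s : ℂ => exp (s • (Complex.I • conjR (gcorner L V c) X)) :=
    exp_continuous.comp (continuous_id.smul continuous_const)
  have h2 : Tendsto (fun s : ℂ => exp (s • (Complex.I • conjR (gcorner L V c) X))) (𝓝 0) (𝓝 1) :=
    h2c.tendsto' 0 1 (by rw [zero_smul, exp_zero])
  have h := (h1.mul h2).mul_const (exp (-Yexp L 𝒯 V c))
  rwa [mul_one, show exp (Yexp L 𝒯 V c) * exp (-Yexp L 𝒯 V c) = 1 from (expU (Yexp L 𝒯 V c)).val_inv] at h

omit [NormOneClass 𝔸] [StarRing 𝔸] [CStarRing 𝔸] [StarModule ℂ 𝔸] in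
/-- **EVENTUALLY IN THE `mlog` REGIME (quotient)**: `‖M_c(V′_sV)M_c(V)⁻¹ − 1‖ ≤ 1∕3` for `s` near `0`. [folklore] -/
theorem eventually_quot_mlogRegime (hL : 0 < L) (h𝒯 : IsBlockLocal L 𝒯) (h𝒯' : IsAxisStraightFamily L 𝒯)
    (V : ZdEdge d → 𝔸ˣ) (c : ZdEdge d) (X : 𝔸)
    (hW : ∀ x ∈ offAxis L c, ‖((loopW L 𝒯 V c x : 𝔸ˣ) : 𝔸) - 1‖ < 1) :
    ∀ᶠ s : ℂ in 𝓝 0,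
      ‖((avgM L 𝒯 (pert (s • Pi.single (b0Z L c) X) V) c * (avgM L 𝒯 V c)⁻¹ : 𝔸ˣ) : 𝔸) - 1‖ ≤ 1 / 3 := by
  have h := ((tendsto_quot_pert_single hL h𝒯 h𝒯' V c X hW).sub_const 1).norm
  rw [sub_self, norm_zero] at h
  exact (h.eventually_lt_const (by norm_num : (0 : ℝ) < 1 / 3)).mono fun s hs => hs.le

omit [NormOneClass 𝔸] [CompleteSpace 𝔸] [CStarRing 𝔸] in
/-- `⋆` of the corridor direction field: `(t·δ_{b₀(c)}X)⋆ = t·δ_{b₀(c)}(X⋆)` for REAL `t`. [folklore] -/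
theorem star_real_smul_single (t : ℝ) (b₀ b : ZdEdge d) (X : 𝔸) :
    star (((t : ℂ) • Pi.single b₀ X : ZdEdge d → 𝔸) b) = ((t : ℂ) • Pi.single b₀ (star X) : ZdEdge d → 𝔸) b := by
  rw [Pi.smul_apply, Pi.smul_apply, star_smul, Complex.star_def, Complex.conj_ofReal]
  by_cases hb : b = b₀
  · subst hb
    rw [Pi.single_eq_same, Pi.single_eq_same]
  · rw [Pi.single_eq_of_ne hb, Pi.single_eq_of_ne hb, star_zero]

omit [NormOneClass 𝔸] in
/-- **`hstar` DISCHARGED FROM ROW S47**: in a C⋆-algebra, over a UNITARY background `V` whose off-axis block loops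
satisfy `‖W_x(V) − 1‖ < 1∕3`, for a block-local, axis-straight, θ-EQUIVARIANT transporter family `𝒯`
(`ShellMeasureAverageReal.theta`, e.g. the printed `gammaT`), the average is ⋆-equivariant ALONG THE CORRIDOR CURVE
for small real `t`: `star (Q̃_V(t•δ_{b₀(c)}X)(c)) = Q̃_V(t•δ_{b₀(c)}(X⋆))(c)` — `ShellMeasureAverageReal.star_Qtilde` BY
NAME, its three `mlog`-regime hypotheses holding eventually by §3's continuity. [folklore] -/
theorem eventually_star_Qtilde_single (hL : 0 < L) (h𝒯 : IsBlockLocal L 𝒯) (h𝒯' : IsAxisStraightFamily L 𝒯)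
    (h𝒯θ : ∀ (U : ZdEdge d → 𝔸ˣ) (x : Fin d → ℤ), 𝒯 (fun b => theta (U b)) x = theta (𝒯 U x))
    {V : ZdEdge d → 𝔸ˣ} (hVu : ∀ b, (V b : 𝔸) ∈ unitary 𝔸) (c : ZdEdge d)
    (hW : ∀ x ∈ offAxis L c, ‖((loopW L 𝒯 V c x : 𝔸ˣ) : 𝔸) - 1‖ < 1 / 3) (X : 𝔸) :
    ∀ᶠ t : ℝ in 𝓝 0, star (Qtilde L 𝒯 V ((t : ℂ) • Pi.single (b0Z L c) X) c)
      = Qtilde L 𝒯 V ((t : ℂ) • Pi.single (b0Z L c) (star X)) c := by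
  have hW1 : ∀ x ∈ offAxis L c, ‖((loopW L 𝒯 V c x : 𝔸ˣ) : 𝔸) - 1‖ < 1 :=
    fun x hx => (hW x hx).trans (by norm_num)
  have hW0 : ∀ x ∈ blockSites L c.1, ‖((loopW L 𝒯 V c x : 𝔸ˣ) : 𝔸) - 1‖ ≤ 1 / 3 :=
    loops_blockSites_of_offAxis h𝒯' V c (by norm_num) fun x hx => (hW x hx).le
  have hev := (eventually_loops_mlogRegime hL h𝒯 h𝒯' V c X hW).and
    (eventually_quot_mlogRegime hL h𝒯 h𝒯' V c X hW1)
  have hevR := (Complex.continuous_ofReal.tendsto' (0 : ℝ) (0 : ℂ) Complex.ofReal_zero).eventually hev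
  filter_upwards [hevR] with t ht
  rw [star_Qtilde h𝒯θ hVu _ c ht.1 hW0 ht.2]
  congr 1
  funext b
  exact star_real_smul_single t (b0Z L c) b X

variable (hL : 0 < L) (h𝒯 : IsBlockLocal L 𝒯) (h𝒯' : IsAxisStraightFamily L 𝒯) (V : ZdEdge d → 𝔸ˣ) {ε : ℝ}
  (hε0 : 0 ≤ ε) (hε : ε ≤ 1 / 8) (hW : ∀ c, ∀ x ∈ offAxis L c, ‖((loopW L 𝒯 V c x : 𝔸ˣ) : 𝔸) - 1‖ ≤ ε)
  (hV : ∀ b, ‖((V b : 𝔸ˣ) : 𝔸)‖ ≤ 1) (hV' : ∀ b, ‖(((V b)⁻¹ : 𝔸ˣ) : 𝔸)‖ ≤ 1)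
  (hbud : (L : ℝ) ^ d / L * (24 * ε) < 1)

include h𝒯 hε in
/-- **p. 267's `h` IS ⋆-EQUIVARIANT OVER A UNITARY BACKGROUND — NO `hstar` BINDER**: in a C⋆-algebra, for a
block-local, axis-straight, θ-equivariant family `𝒯`, a unitary background `V` in the small-loop regime
`‖W_x(V) − 1‖ ≤ ε ≤ 1∕8` and the budget `(Lᵈ∕L)·24ε < 1`: `h(c)(X⋆) = (h(c) X)⋆` for every coarse bond `c` and every
`X` — S46's `hhop`, fibrewise, for the printed average's `h`, from LOCATED hypotheses only. [folklore] -/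
theorem hGen_star_unitary
    (h𝒯θ : ∀ (U : ZdEdge d → 𝔸ˣ) (x : Fin d → ℤ), 𝒯 (fun b => theta (U b)) x = theta (𝒯 U x))
    (hVu : ∀ b, (V b : 𝔸) ∈ unitary 𝔸) (c : ZdEdge d) (X : 𝔸) :
    hGen hL h𝒯' V hε0 hε hW hV hV' hbud c (star X) = star (hGen hL h𝒯' V hε0 hε hW hV hV' hbud c X) :=
  hGen_star hL h𝒯 h𝒯' V hε0 hε hW hV hV' hbud c
    (eventually_star_Qtilde_single hL h𝒯 h𝒯' h𝒯θ hVu c fun x hx => (hW c x hx).trans_lt (by linarith)) X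

include h𝒯 hε in
/-- … and for coarse FIELDS: `hOp b₀ h (B⋆) = (hOp b₀ h B)⋆` (`⋆` componentwise) — S46's `hhop` for the printed
average's `h` over a unitary background, NO `hstar` binder. [folklore] -/
theorem hOp_hGen_star_unitary
    (h𝒯θ : ∀ (U : ZdEdge d → 𝔸ˣ) (x : Fin d → ℤ), 𝒯 (fun b => theta (U b)) x = theta (𝒯 U x))
    (hVu : ∀ b, (V b : 𝔸) ∈ unitary 𝔸) (B : ZdEdge d → 𝔸) :
    hOp (b0Z L) (fun c X => hGen hL h𝒯' V hε0 hε hW hV hV' hbud c X) (star B)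
      = star (hOp (b0Z L) (fun c X => hGen hL h𝒯' V hε0 hε hW hV hV' hbud c X) B) :=
  hOp_hGen_star hL h𝒯 h𝒯' V hε0 hε hW hV hV' hbud
    (fun c => eventually_star_Qtilde_single hL h𝒯 h𝒯' h𝒯θ hVu c fun x hx => (hW c x hx).trans_lt (by linarith)) B

end Unitary

/-! ## §4 The printed instance `𝒯 = Γ` of [B7] (15) -/

section Instance

variable (hL : 0 < L) (V : ZdEdge d → 𝔸ˣ) {ε : ℝ} (hε0 : 0 ≤ ε) (hε : ε ≤ 1 / 8)
  (hW : ∀ c, ∀ x ∈ offAxis L c, ‖((loopW L (fun U : ZdEdge d → 𝔸ˣ => gammaT L U) V c x : 𝔸ˣ) : 𝔸) - 1‖ ≤ ε)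
  (hV : ∀ b, ‖((V b : 𝔸ˣ) : 𝔸)‖ ≤ 1) (hV' : ∀ b, ‖(((V b)⁻¹ : 𝔸ˣ) : 𝔸)‖ ≤ 1)
  (hbud : (L : ℝ) ^ d / L * (24 * ε) < 1)

/-- **[B7] (15) VERBATIM, UNITARY BACKGROUND, NO `hstar` BINDER**: in a C⋆-algebra (e.g. `M_N(ℂ)`), for unitary bond
variables `V` with off-axis block loops `‖W_x(V) − 1‖ ≤ ε ≤ 1∕8` and the budget `(Lᵈ∕L)·24ε < 1`, the fibre maps of
p. 267's `h` for the printed average (15) commute with `⋆` (`theta_gammaT` BY NAME for the θ-equivariance of the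
printed contours). [folklore] -/
theorem hGen_star_gammaT_unitary [StarRing 𝔸] [CStarRing 𝔸] [StarModule ℂ 𝔸]
    (hVu : ∀ b, (V b : 𝔸) ∈ unitary 𝔸) (c : ZdEdge d) (X : 𝔸) :
    hGen hL (isAxisStraightFamily_gammaT hL) V hε0 hε hW hV hV' hbud c (star X)
      = star (hGen hL (isAxisStraightFamily_gammaT hL) V hε0 hε hW hV hV' hbud c X) :=
  hGen_star_unitary hL (isBlockLocal_gammaT hL) (isAxisStraightFamily_gammaT hL) V hε0 hε hW hV hV' hbud
    (theta_gammaT L) hVu c X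

end Instance

end Summit.QuantumFields.BalabanUV.T4Continuum.ShellMeasureAverageHStructure

end
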